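import Mathlib
import Summits.Ventures.PercRepro2.SwOutMultiRootEExempt
import Summits.Ventures.PercRepro2.SwAllMarkStepH1

/-!
# THE GENERAL MARK STEP WITH ANY SET OF JUNCTIONS ADJACENT TO THE MARK AND TO `h` (blind cell
PercRepro2, night-4 g34, 2026-08-29; proofs/NIGHT4-G34.md §9)

The graph-level form of the multi-junction class under (★): **`gTypedSwAll_of_junctions_star`** —
g7's general doubly typed row on every graph with a set `J` of junctions (no loop at `h` or at a
junction; edges between `h` and the junctions and among the junctions allowed; every other vertex
exempt, in `X` (loops only), joined to `l`, or isolated) such that on the side no junction is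
blue-connected to `l` without being red-connected to `l` (★).  Then **THE MARK STEP**:
**`swAll_markStep_of_junctions_star`** — row 2′SW-ALL with the mark `x` on every graph whose vertices
other than `l, h, x` are joined to `l`, hang on the mark, or form a set `J` of junctions EACH
ADJACENT TO THE MARK AND TO `h`: on a pattern of the mark's edges a junction is a blue neighbour of
the mark (then the pattern's `𝓓` forbids `u ∈ C_B(l)`) or a red one (then `𝓓″` forbids
`u ∈ C_R(h)`, so its edge to `h` is blue and `u ∈ C_B(l)` would put `h` into the hull of `l`), so
(★) holds on every pattern.  NO hypothesis on the junctions' other neighbours: this is the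
MIXED JUNCTION of g28–g33's frontier, with any number of junctions, adjacent or not.
-/

namespace Summit.Ventures.PercRepro2

namespace LocRows

open Hull

variable {V : Type*} {E : Type*} [Fintype E] [DecidableEq E]

open scoped Classical

variable {ends : E → Sym2 V} {l h : V} {𝓤 𝓓 𝓓'' : Set (Set V)} {X : Set V} {𝓤' : Set (Set V)}
  {F : V → Prop}

section Graph

/-- **THE MULTI-JUNCTION CLASS UNDER (★) ON THE GRAPH**: the general doubly typed row on every
graph with the junctions `J` in `{l}ᶜ`. -/
theorem gTypedSwAll_of_junctions_star {J : Finset V} (hlh : l ≠ h) (hlJ : l ∉ J)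
    (hloop : ∀ e r, r ∈ insert h (↑J : Set V) → ends e ≠ s(r, r))
    (h𝓤 : IsUpperSet 𝓤) (h𝓓 : IsLowerSet 𝓓) (h𝓓'' : IsLowerSet 𝓓'') (h𝓤' : IsUpperSet 𝓤')
    (hF : ∀ x, F x → ∀ S ∈ 𝓤, x ∈ S) (hhX : h ∉ X) (hJX : ∀ u ∈ J, u ∉ X)
    (hX : ∀ x ∈ X, x ≠ l → ∀ e, x ∈ ends e → ends e = s(x, x))
    (hout : ∀ x, x ≠ l → x ≠ h → x ∉ J →
      F x ∨ x ∈ X ∨ (∃ e, ends e = s(x, l)) ∨ (∀ e, x ∉ ends e))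
    (hstar : ∀ ξ ζ, ζ ∈ gOutSide ends l h 𝓤 𝓓 𝓓'' X 𝓤' ({l}ᶜ) ξ → ∀ u ∈ J,
      u ∈ cluster ends (blue ζ) l → u ∈ cluster ends ζ l) :
    GTypedSwAll ends l h 𝓤 𝓓 𝓓'' X 𝓤' := by
  refine exists_swAll_injection_of_card_le h _ (card_le_g_of_classes hlh fun ξ 𝓔 h𝓔 => ?_)
  refine rigidOK_g_of_junctions_starE (J := J) (F := F) h𝓤 h𝓓 h𝓓'' h𝓤' (by simp) hloop hF ?_ ?_
    hhX hJX ?_ h𝓔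
  · intro x hx hxh hxJ
    rcases hout x (by simpa using hx) hxh hxJ with hf | hxX | ⟨e, he⟩ | hiso
    · exact Or.inl hf
    · exact Or.inr (Or.inl hxX)
    · exact Or.inr (Or.inr (Or.inl ⟨e, l, he, by simp⟩))
    · exact Or.inr (Or.inr (Or.inr hiso))
  · intro x hx hxU
    exact hX x hx (by simpa using hxU)
  · intro ζ hζ u hu hesc
    have hl : l ∈ hull ends ζ u := by
      by_contra h'
      exact hesc fun y hy => by
        simp only [Set.mem_compl_iff, Set.mem_singleton_iff]
        rintro rfl; exact h' hy
    rcases hl with hl | hl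
    · exact conn_symm hl
    · exact hstar ξ ζ hζ u hu (conn_symm hl)

end Graph

section MarkStep

variable {x : V}

omit [Fintype E] [DecidableEq E] in
/-- No loop at a junction of the isolated graph when there is none in the graph. -/
lemma isolate_hloop_set {J : Finset V} (hxh : x ≠ h) (hxJ : x ∉ J)
    (hloop : ∀ e r, r ∈ insert h (↑J : Set V) → ends e ≠ s(r, r)) :
    ∀ e r, r ∈ insert h (↑J : Set V) → isolate ends x e ≠ s(r, r) := by
  intro e r hr he
  have hrx : r ≠ x := by
    rintro rfl
    rcases hr with rfl | hr
    · exact hxh rfl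
    · exact hxJ hr
  by_cases hxe : x ∈ ends e
  · rw [isolate_apply_of_mem hxe, Sym2.eq_iff] at he
    rcases he with ⟨h', -⟩ | ⟨h', -⟩ <;> exact hrx h'.symm
  · rw [isolate_apply_of_notMem hxe] at he
    exact hloop e r hr he

/-- **THE GENERAL MARK STEP WITH ANY SET OF JUNCTIONS ADJACENT TO THE MARK AND TO `h`**: row 2′SW-ALL
with the mark `x` on every graph whose vertices other than `l, h, x` are joined to `l`, hang on the
mark, or belong to a set `J` of junctions each joined to the mark and to `h` (no loop at `h` or at a
junction; `l, h, x ∉ J`). -/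
theorem swAll_markStep_of_junctions_star (hlh : l ≠ h) (hloop : ∀ e, ends e ≠ s(h, h))
    (hxl : x ≠ l) (hxh : x ≠ h) {J : Finset V} (hlJ : l ∉ J) (hhJ : h ∉ J) (hxJ : x ∉ J)
    (hloopJ : ∀ u ∈ J, ∀ e, ends e ≠ s(u, u))
    (hJx : ∀ u ∈ J, ∃ e, ends e = s(x, u)) (hJh : ∀ u ∈ J, ∃ e, ends e = s(h, u))
    (hout : ∀ y, y ≠ l → y ≠ h → y ≠ x → y ∉ J →
      (∃ e, ends e = s(y, l)) ∨ (∀ e, y ∈ ends e → x ∈ ends e)) : SwAll ends l h x := by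
  refine swAll_of_gTyped_patterns hxl hxh fun d _ => ?_
  have hloop' : ∀ e r, r ∈ insert h (↑J : Set V) → ends e ≠ s(r, r) := by
    rintro e r (rfl | hr)
    · exact hloop e
    · exact hloopJ r hr e
  refine gTypedSwAll_of_junctions_star
    (F := fun y => y ∈ openNbrs ends d x ∧ ∀ z ∈ openNbrs ends d x, z = y) (J := J)
    hlh hlJ (isolate_hloop_set hxh hxJ hloop') (isUpperSet_markU d x) (isLowerSet_markD d x)
    (isLowerSet_markD'' d x) isUpperSet_univ ?_ ?_ ?_ ?_ ?_ ?_
  · -- the unique red neighbour is forced into `C_R(l)`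
    rintro y ⟨-, huniq⟩ S ⟨z, hz, hzS⟩
    rw [← huniq z hz]
    exact hzS
  · exact fun h' => hxh (Set.mem_singleton_iff.1 h').symm
  · intro u hu h'
    exact hxJ ((Set.mem_singleton_iff.1 h') ▸ hu)
  · intro y hy _ e hye
    rw [Set.mem_singleton_iff] at hy
    subst hy
    exact isolate_selfLoops e hye
  · intro y hyl hyh hyJ
    by_cases hyx : y = x
    · exact Or.inr (Or.inl (by rw [hyx]; exact Set.mem_singleton _))
    by_cases hyF : y ∈ openNbrs ends d x ∧ ∀ z ∈ openNbrs ends d x, z = y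
    · exact Or.inl hyF
    rcases hout y hyl hyh hyx hyJ with ⟨e, he⟩ | hiso
    · exact Or.inr (Or.inr (Or.inl ⟨e, isolate_eq_of_ends_eq hyx hxl.symm he⟩))
    · exact Or.inr (Or.inr (Or.inr (isolate_iso hyx hiso)))
  · -- (★): a junction blue-connected to `l` is red-connected to `l`
    intro ξ ζ hζ u hu hbl
    exfalso
    have hQ := (mem_gOutSide.1 hζ).1
    rw [mem_gTypedQ] at hQ
    obtain ⟨hh, -, hB, hRh, -, -⟩ := hQ
    have hux : u ≠ x := fun h' => hxJ (h' ▸ hu)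
    obtain ⟨e, he⟩ := hJx u hu
    by_cases hde : d e = true
    · -- `u` is a red neighbour of the mark: `u ∉ C_R(h)`, so its edge to `h` is blue
      have huR : u ∈ openNbrs ends d x := ⟨hux, e, hde, he⟩
      have hnot : u ∉ cluster (isolate ends x) ζ h := hRh u huR
      obtain ⟨e', he'⟩ := hJh u hu
      have he'' : isolate ends x e' = s(h, u) := isolate_eq_of_ends_eq hxh.symm hux he'
      cases hζe : ζ e' with
      | true => exact hnot (mem_cluster_of_edge (mem_cluster_self _ _ _) hζe he'')
      | false =>
        have hζe' : blue ζ e' = true := by rw [blue_eq_true_iff]; exact hζe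
        have huh : u ∈ cluster (isolate ends x) (blue ζ) h :=
          mem_cluster_of_edge (mem_cluster_self _ _ _) hζe' he''
        exact hh (Or.inr (conn_trans hbl (conn_symm huh)))
    · -- `u` is a blue neighbour of the mark: `𝓓` forbids `u ∈ C_B(l)`
      have hde' : blue d e = true := by rw [blue_eq_true_iff]; simpa using hde
      exact hB u ⟨hux, e, hde', he⟩ hbl

/-- **Row (SW) from the general mark step with any set of junctions adjacent to the mark and to
`h`.** -/
theorem sw_markStep_of_junctions_star (hlh : l ≠ h) (hloop : ∀ e, ends e ≠ s(h, h))
    (hxl : x ≠ l) (hxh : x ≠ h) {J : Finset V} (hlJ : l ∉ J) (hhJ : h ∉ J) (hxJ : x ∉ J)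
    (hloopJ : ∀ u ∈ J, ∀ e, ends e ≠ s(u, u))
    (hJx : ∀ u ∈ J, ∃ e, ends e = s(x, u)) (hJh : ∀ u ∈ J, ∃ e, ends e = s(h, u))
    (hout : ∀ y, y ≠ l → y ≠ h → y ≠ x → y ∉ J →
      (∃ e, ends e = s(y, l)) ∨ (∀ e, y ∈ ends e → x ∈ ends e)) : Sw ends l h x :=
  sw_of_swAll ends (swAll_markStep_of_junctions_star hlh hloop hxl hxh hlJ hhJ hxJ hloopJ hJx hJh hout)

end MarkStep

end LocRows

end Summit.Ventures.PercRepro2
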